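import Summits.MatrixMultiplication.OmegaCensus.STPPVosperSlackOneCoverStepsW

/-!
# ω-census (abelian STPP census): the admissible-offset checker with the DISJOINTNESS (cardinality) test (kernel)

HONEST FRAMING (pub-omega census; verbatim): lottery ticket; floor = certified bounds/negative ranges.
Census STRUCTURE (seat pub-omega-stpp-2 gen 25, 2026-08-28), family (b2).  `alpha2AdmOKd`: as `alpha2AdmOK` (`STPPVosperSlackOneCoverStepsW.lean`) but a pair of run
starts `(t₁, t₂)` only counts as admissible when, besides the two window tests and the prefix test, the union of the two runs has the full `L + 2` points (the
runs are disjoint) — which the genuine configuration of case α₂ satisfies (`|−Aᵢ + Y°| = L + 2`).  Companion of the law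
`no_isSTPP_of_slack_one_coverW2_prime_a2` (`STPPVosperSlackOneCoverLawA2Wd.lean`), whose α₂ hypothesis carries this premise; without it, coincident or
overlapping runs produce spurious admissible offsets.  Nothing here is progress on `ω`.
-/

open Finset

namespace Summit.MatrixMultiplication.OmegaCensus.CubeNB

/-- **Admissible offsets of one `(j, ℓ₁)` with the disjointness test** (`Bool`). [folklore] -/
def alpha2AdmOKd (p n₁ L r : ℕ) (J : Finset ℕ) (j ℓ₁ : ℕ) (D : List ℕ) : Bool :=
  decide (j ∈ J) ||
    ((List.range p).filter fun t₁ => (List.range (ℓ₁ + 1)).all fun i => decide ((t₁ + j * i) % p < n₁)).all fun t₁ =>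
      ((List.range p).filter fun t₂ => (List.range (L - ℓ₁ + 1)).all fun i => decide ((t₂ + j * i) % p < n₁)).all fun t₂ =>
        !(decide (#((range (ℓ₁ + 1)).image (fun i => (t₁ + j * i) % p) ∪ (range (L - ℓ₁ + 1)).image (fun i => (t₂ + j * i) % p)) = L + 2)) ||
        !(prefixOK r ((range (ℓ₁ + 1)).image (fun i => (t₁ + j * i) % p) ∪ (range (L - ℓ₁ + 1)).image (fun i => (t₂ + j * i) % p))) ||
          decide ((t₂ + p - t₁) % p ∈ D)

/-- **Meaning of `alpha2AdmOKd`.** [folklore] -/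
theorem alpha2AdmOKd_spec {p n₁ L r : ℕ} {J : Finset ℕ} {j ℓ₁ : ℕ} {D : List ℕ} (h : alpha2AdmOKd p n₁ L r J j ℓ₁ D = true) :
    ∀ t₁ < p, ∀ t₂ < p, (∀ i < ℓ₁ + 1, (t₁ + j * i) % p < n₁) → (∀ i < L - ℓ₁ + 1, (t₂ + j * i) % p < n₁) →
      #((range (ℓ₁ + 1)).image (fun i => (t₁ + j * i) % p) ∪ (range (L - ℓ₁ + 1)).image (fun i => (t₂ + j * i) % p)) = L + 2 →
      prefixOK r ((range (ℓ₁ + 1)).image (fun i => (t₁ + j * i) % p) ∪ (range (L - ℓ₁ + 1)).image (fun i => (t₂ + j * i) % p)) = true →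
      j ∈ J ∨ (t₂ + p - t₁) % p ∈ D := by
  intro t₁ ht₁ t₂ ht₂ hw1 hw2 hcard hpre
  rw [alpha2AdmOKd, Bool.or_eq_true, decide_eq_true_eq] at h
  rcases h with hJ | h
  · exact Or.inl hJ
  right
  rw [List.all_eq_true] at h
  have hT₁ : t₁ ∈ (List.range p).filter fun t₁ => (List.range (ℓ₁ + 1)).all fun i => decide ((t₁ + j * i) % p < n₁) := by
    rw [List.mem_filter, List.mem_range, List.all_eq_true]
    exact ⟨ht₁, fun i hi => decide_eq_true (hw1 i (List.mem_range.1 hi))⟩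
  have h2 := h t₁ hT₁
  rw [List.all_eq_true] at h2
  have hT₂ : t₂ ∈ (List.range p).filter fun t₂ => (List.range (L - ℓ₁ + 1)).all fun i => decide ((t₂ + j * i) % p < n₁) := by
    rw [List.mem_filter, List.mem_range, List.all_eq_true]
    exact ⟨ht₂, fun i hi => decide_eq_true (hw2 i (List.mem_range.1 hi))⟩
  have h3 := h2 t₂ hT₂
  rw [Bool.or_eq_true, Bool.or_eq_true, Bool.not_eq_true', Bool.not_eq_true', decide_eq_false_iff_not, decide_eq_true_eq, hpre] at h3
  rcases h3 with (h3 | h3) | h3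
  · exact absurd hcard h3
  · exact absurd h3 (by decide)
  · exact h3

end Summit.MatrixMultiplication.OmegaCensus.CubeNB
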